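/-
Copyright (c) 2026. Released under the Apache 2.0 license.
-/
import Literature.NumberTheory.EllipticCurves.ManinConstantGamma1Gamma0Comparison
import Literature.NumberTheory.EllipticCurves.NeronIsogenyScalingHoldsProofs
import Literature.NumberTheory.EllipticCurves.ModularCurveManinSemistableBridgeProofs
import Literature.NumberTheory.EllipticCurves.ShimuraSubgroupHeckeCongruence
import Literature.NumberTheory.EllipticCurves.CuspFormLFunctionLevelConductorProofs
import HarnessLib

/-!
# The `X₁(N)`- and `X₀(N)`-optimal Manin constants differ at most by one traceless prime:
# discharge of ČNS Lemma 6.5 (`c₁ ∣ c₀`) and its Ling–Oesterlé converse (`c₀ ∣ p·c₁`)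

[Proofs] Theorems only (no definition, no named fact). Topic `Literature/NumberTheory/EllipticCurves`;
namespace `Literature.NumberTheory.EllipticCurves.ModularForms` (that of the discharged fact).

The source. K. Česnavičius, M. Neururer, A. Saha, *The Manin constant and the modular degree*, J. Eur. Math.
Soc. 26 (2024) 573–637 (bib key `CesnaviciusNeururerSaha2023`), **Lemma 6.5** (p. 614 = authors' version
p. 42; = K. Česnavičius, Compos. Math. 154 (2018), Lemma 2.12): for isogenous newform quotients
`π : J₁(N) ↠ E`, `π′ : J₀(N) ↠ E′` with connected kernels, "`c_π′ = c_π · #Coker(Lie 𝓔 → Lie 𝓔′)`", in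
particular `c_π ∣ c_π′`.  The tree's rendering of that consequence is the NAMED FACT
`cesnaviciusNeururerSaha_lemma_6_5_dvd` (`ManinConstantGamma1Gamma0Comparison.lean`), so far statement-only
and carried as the hypothesis `h65` by its printed uses there, by
`ManinConstantGamma1Gamma0ComparisonProofs.lean`, and by the cell bsd-f2-manin's `Γ₀/Γ₁` ledger.

## What is proved here

* **DISCHARGE** `cesnaviciusNeururerSaha_lemma_6_5_dvd_holds`.  Route (not the printed one through Néron
  models of `𝓔 → 𝓔′`, which the tree lacks, but through the tree's substitute for the Néron mapping
  property): both data have the SAME newform `f` (`IsNewformOf.of_isIsogenous`, `IsNewformOf.unique`: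
  isogenous curves have equal `aₙ`), `Λ_{E₁} = c₁ Λ₁(f)` (optimality of the `X₁(N)`-datum) and
  `Λ₁(f) ⊆ Λ₀(f)` (`periodLatticeGamma1_le_periodLattice`), `c₀ Λ₀(f) ⊆ Λ_{E₀}` (any `X₀(N)`-datum), so the
  RATIONAL number `q = c₀/c₁` satisfies `q Λ_{E₁} ⊆ Λ_{E₀}`; both models being globally minimal, `q ∈ ℤ` by
  the integrality of the Néron scaling of a rational isogeny
  (`integral_neronScaling_of_isGloballyMinimal_holds`, Silverman *ATAEC* IV.5.1/IV.6.1/IV.9.1, a tree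
  THEOREM).  The proof uses only the optimality of the `X₁(N)`-datum: `c₁` divides the constant of EVERY
  `X₀(N)`-datum of every globally minimal curve of the class
  (`Gamma1ParametrizationData.IsOptimal.maninConstant_dvd_maninConstant`; ČNS §1: "any `φ` factors through
  an optimal one").
* **CONVERSE AT A TRACELESS PRIME** (Ling–Oesterlé 1991, Thm. 6, in the tree's period-lattice form
  `pMulLatticeLeGamma1OfTracelessPrime_holds`: `a_p(f) = 0`, `p ∣ N` ⇒ `p Λ₀(f) ⊆ Λ₁(f)`): for an OPTIMAL
  `X₀(N)`-datum `D₀` (`Λ_{E₀} = c₀ Λ₀(f)`) and ANY `X₁(N)`-datum `D₁` of an isogenous globally minimal curve,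
  `c₀ ∣ p · c₁` (`(p c₁/c₀) Λ_{E₀} ⊆ Λ_{E₁}`, Néron scaling again):
  `ModularParametrizationData.maninConstant_dvd_mul_maninConstant_of_cuspCoeff_eq_zero`.
* **LEDGER**: for the two OPTIMAL data of one class at a level with a traceless prime `p`
  (in particular `p² ∣ N`, Atkin–Lehner: `IsNewform0.cuspCoeff_eq_zero_of_sq_dvd`), `|c₀| = |c₁|` or
  `|c₀| = p |c₁|` (`natAbs_maninConstant₀_eq_or_eq_mul_of_cuspCoeff_eq_zero`, `…_of_sq_dvd_level`; at
  `4 ∣ N`: `|c₀| ∈ {|c₁|, 2|c₁|}`, at `9 ∣ N`: `|c₀| ∈ {|c₁|, 3|c₁|}`), `ord_ℓ(c₀) = ord_ℓ(c₁)` at every prime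
  `ℓ ≠ p`, and two distinct traceless primes force `|c₀| = |c₁|` (Stevens' and Manin's constants agree up to
  sign; cf. the lattice statement `Gamma1LatticeEqOfTwoTracelessPrimes` of
  `ShimuraSubgroupHeckeCongruence.lean`).  In print the relation is `c₀ = c₁ · n_θ` with `n_θ ∣ deg θ ∣ #Σ(N)`
  (ČNS Lemma 6.5 with Ling–Oesterlé Thm. 1); the bound `n_θ ∈ {1, p}` at a traceless prime is the lattice
  shadow proved here.

NOT here: the cokernel identity of Lemma 6.5 itself (Néron models), and which alternative holds at a single
traceless prime (the cell's open rows E-an-66/67: `|c₀| = |c₁|` unless a NON-blind rational `2`-torsion point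
generates the Shimura cover).

## References
* [CesnaviciusNeururerSaha2023] op. cit., Lemma 6.5 and §1 (p. 574 with fn. 2).
* [Cesnavicius2018] K. Česnavičius, *The Manin constant in the semistable case*, Compos. Math. 154 (2018),
  Lemma 2.12 (held: paper:arxiv-1703.02951 p0007).
* [LingOesterle1991] S. Ling, J. Oesterlé, *The Shimura subgroup of `J₀(N)`*, Astérisque 196–197 (1991),
  Thm. 6 (p. 176).
* [AtkinLehner1970] A. O. L. Atkin, J. Lehner, *Hecke operators on `Γ₀(m)`*, Math. Ann. 185 (1970), Thm. 3.
* [SilvermanATAEC1994] J. H. Silverman, *Advanced topics*, GTM 151, IV.5.1, IV.6.1, Cor. IV.9.1.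
* [Stevens1989] G. Stevens, Invent. Math. 98 (1989), §2 (the `X₁(N)`-optimal curve; Thm. 1.6 `c ∈ ℤ`).
-/

noncomputable section

open scoped MatrixGroups ModularForm

open CongruenceSubgroup WeierstrassCurve

namespace Literature.NumberTheory.EllipticCurves.ModularForms

variable {W₁ W₀ : WeierstrassCurve ℚ} [W₁.IsElliptic] [W₁.IsGloballyMinimal] [W₀.IsElliptic]
  [W₀.IsGloballyMinimal] {N : ℕ} [NeZero N]

/-! ### Same class, same newform -/

omit [W₁.IsGloballyMinimal] [W₀.IsGloballyMinimal] in
/-- **An `X₁(N)`-datum and an `X₀(N)`-datum of two isogenous curves have the same newform** (isogenous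
curves have the same `aₙ`, `IsNewformOf.of_isIsogenous`, Faltings 1983 / Knapp Thm. 11.67; a cusp form is
determined by its `q`-expansion, `IsNewformOf.unique`). [cite: Knapp1993, Thm. 11.67 (PDF p. 281)] -/
theorem Gamma1ParametrizationData.f_eq_of_isIsogenous (D₁ : Gamma1ParametrizationData W₁ N)
    (D₀ : ModularParametrizationData W₀ N) (hiso : IsIsogenous W₁ W₀) : D₁.f = D₀.f :=
  D₁.isNewformOf.unique (D₀.isNewformOf.of_isIsogenous hiso)

/-! ### ČNS Lemma 6.5, divisibility form: `c₁ ∣ c₀` — discharge -/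

/-- **The `X₁(N)`-optimal Manin constant divides the Manin constant of every `X₀(N)`-parametrisation
of the class.**  For globally minimal `ℚ`-isogenous elliptic `W₁, W₀`, an OPTIMAL `X₁(N)`-datum `D₁` of
`W₁` (`Λ_{E₁} = c₁ Λ₁(f)`: Stevens' curve, "`Ker(J₁(N) ↠ E₁)` connected") and ANY `X₀(N)`-datum `D₀` of
`W₀` at the same level: `c₁ ∣ c₀`.  Proof: the data share their newform `f`; `(c₀/c₁) Λ_{E₁} =
c₀ Λ₁(f) ⊆ c₀ Λ₀(f) ⊆ Λ_{E₀}`, so `c₀/c₁ ∈ ℤ` by the integrality of the Néron scaling of the rational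
isogeny `z ↦ (c₀/c₁) z` between the two globally minimal models
(`integral_neronScaling_of_isGloballyMinimal_holds`).  (ČNS Lemma 6.5 gives this with `D₀` optimal, as
`c₀ = c₁ · #Coker(Lie 𝓔₁ → Lie 𝓔₀)`; §1 ibid.: every parametrisation factors through the optimal one.)
[cite: CesnaviciusNeururerSaha2023, Lemma 6.5 and §1 fn. 2] -/
theorem Gamma1ParametrizationData.IsOptimal.maninConstant_dvd_maninConstant
    {D₁ : Gamma1ParametrizationData W₁ N} (h₁ : D₁.IsOptimal) (D₀ : ModularParametrizationData W₀ N)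
    (hiso : IsIsogenous W₁ W₀) : D₁.maninConstant ∣ D₀.maninConstant := by
  have hf : D₁.f = D₀.f := D₁.f_eq_of_isIsogenous D₀ hiso
  have hc₁ : (D₁.c : ℚ) ≠ 0 := by exact_mod_cast D₁.maninConstant_ne_zero
  have hc₁C : (D₁.c : ℂ) ≠ 0 := by exact_mod_cast D₁.maninConstant_ne_zero
  obtain ⟨k, hk⟩ := integral_neronScaling_of_isGloballyMinimal_holds W₁ W₀ D₁.L D₀.L
    D₁.isNeronLattice D₀.isNeronLattice ((D₀.c : ℚ) / D₁.c) (fun z hz ↦ by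
      obtain ⟨w, hw, rfl⟩ := h₁ z hz
      have hw₀ : w ∈ periodLattice D₀.f := hf ▸ periodLatticeGamma1_le_periodLattice D₁.f hw
      have e : ((((D₀.c : ℚ) / D₁.c : ℚ)) : ℂ) * ((D₁.c : ℂ) * w) = (D₀.c : ℂ) * w := by
        push_cast
        field_simp
      rw [e]
      exact D₀.smul_periodLattice_le w hw₀)
  refine ⟨k, ?_⟩
  have e : (D₀.c : ℚ) = D₁.c * k := by
    rw [hk]
    field_simp
  change D₀.c = D₁.c * k
  exact_mod_cast e

/-- **DISCHARGE of the named fact `cesnaviciusNeururerSaha_lemma_6_5_dvd`** (Česnavičius–Neururer–Saha 2024,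
Lemma 6.5 = Česnavičius 2018, Lemma 2.12, divisibility consequence at `Γ = Γ₁(N) ⊂ Γ′ = Γ₀(N)`): for the
optimal `X₁(N)`-datum `D₁` and the optimal `X₀(N)`-datum `D₀` of two isogenous globally minimal curves,
`c₁ ∣ c₀`.  By `Gamma1ParametrizationData.IsOptimal.maninConstant_dvd_maninConstant` (the `X₀`-optimality
hypothesis of the fact is not needed). [cite: CesnaviciusNeururerSaha2023, Lemma 6.5] [cite: Cesnavicius2018, Lemma 2.12] -/
theorem cesnaviciusNeururerSaha_lemma_6_5_dvd_holds : cesnaviciusNeururerSaha_lemma_6_5_dvd :=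
  fun _W₁ _W₀ _ _ _ _ _N _ _D₁ D₀ hiso h₁ _h₀ ↦ h₁.maninConstant_dvd_maninConstant D₀ hiso

/-! ### The Ling–Oesterlé converse at a traceless prime: `c₀ ∣ p · c₁` -/

/-- **At a traceless prime the `X₀(N)`-optimal constant divides `p` times every `X₁(N)`-constant of the
class.**  For globally minimal `ℚ`-isogenous elliptic `W₁, W₀`, an OPTIMAL `X₀(N)`-datum `D₀` of `W₀`
(`Λ_{E₀} = c₀ Λ₀(f)`), ANY `X₁(N)`-datum `D₁` of `W₁` at the same level, and a prime `p ∣ N` with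
`a_p(f) = 0` (an additive prime of the class; `T_p = U_p` acts by `0`): `c₀ ∣ p · c₁`.  Proof: Ling–Oesterlé's
`T_p = p` on the Shimura subgroup gives `p Λ₀(f) ⊆ Λ₁(f)` (`pMulLatticeLeGamma1OfTracelessPrime_holds`), so
`(p c₁/c₀) Λ_{E₀} = p c₁ Λ₀(f) ⊆ c₁ Λ₁(f) ⊆ Λ_{E₁}` and `p c₁/c₀ ∈ ℤ` by the integral Néron scaling
(`integral_neronScaling_of_isGloballyMinimal_holds`).
[cite: LingOesterle1991, Thm. 6 (p. 176): «T_p = p on Σ(N) for p ∣ N»; Manin-constant consequence proved here]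
[cite: CesnaviciusNeururerSaha2023, Lemma 6.5] -/
theorem ModularParametrizationData.maninConstant_dvd_mul_maninConstant_of_cuspCoeff_eq_zero
    (D₀ : ModularParametrizationData W₀ N)
    (h₀ : ∀ z ∈ D₀.L.lattice, ∃ w ∈ periodLattice D₀.f, z = D₀.c * w)
    (D₁ : Gamma1ParametrizationData W₁ N) (hiso : IsIsogenous W₁ W₀) {p : ℕ} (hp : p.Prime)
    (hpN : p ∣ N) (hap : cuspCoeff D₀.f p = 0) :
    D₀.maninConstant ∣ (p : ℤ) * D₁.maninConstant := by
  have hf : D₁.f = D₀.f := D₁.f_eq_of_isIsogenous D₀ hiso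
  have hc₀ : (D₀.c : ℚ) ≠ 0 := by exact_mod_cast D₀.maninConstant_ne_zero_holds
  have hc₀C : (D₀.c : ℂ) ≠ 0 := by exact_mod_cast D₀.maninConstant_ne_zero_holds
  obtain ⟨k, hk⟩ := integral_neronScaling_of_isGloballyMinimal_holds W₀ W₁ D₀.L D₁.L
    D₀.isNeronLattice D₁.isNeronLattice ((((p : ℤ) * D₁.c : ℤ) : ℚ) / D₀.c) (fun z hz ↦ by
      obtain ⟨w, hw, rfl⟩ := h₀ z hz
      have hpw₀ : (p : ℂ) * w ∈ periodLatticeGamma1 D₀.f :=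
        pMulLatticeLeGamma1OfTracelessPrime_holds N D₀.f D₀.isNewformOf.1 p hp hpN hap w hw
      have hpw : (p : ℂ) * w ∈ periodLatticeGamma1 D₁.f := by rw [hf]; exact hpw₀
      have e : ((((((p : ℤ) * D₁.c : ℤ) : ℚ) / D₀.c : ℚ)) : ℂ) * ((D₀.c : ℂ) * w) =
          (D₁.c : ℂ) * ((p : ℂ) * w) := by
        push_cast
        field_simp
      rw [e]
      exact D₁.smul_periodLatticeGamma1_le _ hpw)
  refine ⟨k, ?_⟩
  have e : (((p : ℤ) * D₁.c : ℤ) : ℚ) = D₀.c * k := by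
    rw [hk]
    field_simp
  change (p : ℤ) * D₁.c = D₀.c * k
  exact_mod_cast e

/-! ### The ledger for the two optimal data of a class -/

/-- **`|c₀| = |c₁|` or `|c₀| = p |c₁|` at a traceless prime.**  For the optimal `X₁(N)`-datum `D₁` and the
optimal `X₀(N)`-datum `D₀` of two isogenous globally minimal curves and a prime `p ∣ N` with `a_p(f) = 0`:
`c₁ ∣ c₀ ∣ p c₁`, so `|c₀| ∈ {|c₁|, p |c₁|}` — the two optimal Manin constants of a class differ at most
by the single traceless prime.  (In print: `c₀ = c₁ · n_θ`, `n_θ ∣ deg θ`, `θ` the Shimura cover, killed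
by `p` by Ling–Oesterlé.)
[cite: LingOesterle1991, Thm. 6 (p. 176); Manin-constant consequence proved here]
[cite: CesnaviciusNeururerSaha2023, Lemma 6.5] -/
theorem natAbs_maninConstant₀_eq_or_eq_mul_of_cuspCoeff_eq_zero (D₁ : Gamma1ParametrizationData W₁ N)
    (D₀ : ModularParametrizationData W₀ N) (hiso : IsIsogenous W₁ W₀) (h₁ : D₁.IsOptimal)
    (h₀ : ∀ z ∈ D₀.L.lattice, ∃ w ∈ periodLattice D₀.f, z = D₀.c * w) {p : ℕ} (hp : p.Prime)
    (hpN : p ∣ N) (hap : cuspCoeff D₀.f p = 0) :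
    D₀.maninConstant.natAbs = D₁.maninConstant.natAbs ∨
      D₀.maninConstant.natAbs = p * D₁.maninConstant.natAbs := by
  obtain ⟨k, hk⟩ := h₁.maninConstant_dvd_maninConstant D₀ hiso
  obtain ⟨m, hm⟩ := D₀.maninConstant_dvd_mul_maninConstant_of_cuspCoeff_eq_zero h₀ D₁ hiso hp hpN hap
  have hc₁ : D₁.maninConstant ≠ 0 := D₁.maninConstant_ne_zero
  have hkm : k * m = p := by
    have h : D₁.maninConstant * (k * m) = D₁.maninConstant * p := by
      rw [← mul_assoc, ← hk, ← hm, mul_comm]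
    exact mul_left_cancel₀ hc₁ h
  have hkdvd : k.natAbs ∣ p := by
    refine ⟨m.natAbs, ?_⟩
    rw [← Int.natAbs_mul, hkm, Int.natAbs_natCast]
  rw [hk, Int.natAbs_mul]
  rcases (Nat.dvd_prime hp).mp hkdvd with h | h
  · left
    rw [h, mul_one]
  · right
    rw [h, mul_comm]

/-- **`|c₀| ∈ {|c₁|, p |c₁|}` whenever `p² ∣ N`** (`a_p(f) = 0` for a newform of level `N` with `p² ∣ N`:
Atkin–Lehner 1970, Thm. 3, tree `IsNewform0.cuspCoeff_eq_zero_of_sq_dvd`).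
[cite: AtkinLehner1970, Thm. 3] [cite: LingOesterle1991, Thm. 6 (p. 176); consequence proved here] -/
theorem natAbs_maninConstant₀_eq_or_eq_mul_of_sq_dvd_level (D₁ : Gamma1ParametrizationData W₁ N)
    (D₀ : ModularParametrizationData W₀ N) (hiso : IsIsogenous W₁ W₀) (h₁ : D₁.IsOptimal)
    (h₀ : ∀ z ∈ D₀.L.lattice, ∃ w ∈ periodLattice D₀.f, z = D₀.c * w) {p : ℕ} (hp : p.Prime)
    (hp2 : p ^ 2 ∣ N) :
    D₀.maninConstant.natAbs = D₁.maninConstant.natAbs ∨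
      D₀.maninConstant.natAbs = p * D₁.maninConstant.natAbs :=
  natAbs_maninConstant₀_eq_or_eq_mul_of_cuspCoeff_eq_zero D₁ D₀ hiso h₁ h₀ hp
    ((dvd_pow_self p two_ne_zero).trans hp2) (D₀.isNewformOf.1.cuspCoeff_eq_zero_of_sq_dvd hp hp2)

/-- **At `4 ∣ N`: `|c₀| = |c₁|` or `|c₀| = 2 |c₁|`** — the numeric half of the cell bsd-f2-manin's row E-an-67
(`ShimuraLedgerAtFour`), unconditionally; which alternative holds is the open part (non-blind rational
`2`-torsion). [cite: LingOesterle1991, Thm. 6 (p. 176); consequence proved here] [cite: CesnaviciusNeururerSaha2023, Lemma 6.5] -/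
theorem natAbs_maninConstant₀_eq_or_eq_two_mul_of_four_dvd_level (D₁ : Gamma1ParametrizationData W₁ N)
    (D₀ : ModularParametrizationData W₀ N) (hiso : IsIsogenous W₁ W₀) (h₁ : D₁.IsOptimal)
    (h₀ : ∀ z ∈ D₀.L.lattice, ∃ w ∈ periodLattice D₀.f, z = D₀.c * w) (h4 : 2 ^ 2 ∣ N) :
    D₀.maninConstant.natAbs = D₁.maninConstant.natAbs ∨
      D₀.maninConstant.natAbs = 2 * D₁.maninConstant.natAbs :=
  natAbs_maninConstant₀_eq_or_eq_mul_of_sq_dvd_level D₁ D₀ hiso h₁ h₀ Nat.prime_two h4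

/-- **At `9 ∣ N`: `|c₀| = |c₁|` or `|c₀| = 3 |c₁|`.**
[cite: LingOesterle1991, Thm. 6 (p. 176); consequence proved here] [cite: CesnaviciusNeururerSaha2023, Lemma 6.5] -/
theorem natAbs_maninConstant₀_eq_or_eq_three_mul_of_nine_dvd_level (D₁ : Gamma1ParametrizationData W₁ N)
    (D₀ : ModularParametrizationData W₀ N) (hiso : IsIsogenous W₁ W₀) (h₁ : D₁.IsOptimal)
    (h₀ : ∀ z ∈ D₀.L.lattice, ∃ w ∈ periodLattice D₀.f, z = D₀.c * w) (h9 : 3 ^ 2 ∣ N) :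
    D₀.maninConstant.natAbs = D₁.maninConstant.natAbs ∨
      D₀.maninConstant.natAbs = 3 * D₁.maninConstant.natAbs :=
  natAbs_maninConstant₀_eq_or_eq_mul_of_sq_dvd_level D₁ D₀ hiso h₁ h₀ Nat.prime_three h9

/-- **Two distinct traceless primes force `|c₀| = |c₁|`**: Stevens' `X₁(N)`-optimal constant and Manin's
`X₀(N)`-optimal constant of the class agree up to sign (e.g. two additive primes; `36 ∣ N`).  From
`|c₀| ∈ {|c₁|, p|c₁|} ∩ {|c₁|, q|c₁|}` and `c₁ ≠ 0`.  (Lattice form: `Λ₁(f) = Λ₀(f)`,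
`Gamma1LatticeEqOfTwoTracelessPrimes`.)
[cite: LingOesterle1991, Thm. 6 (p. 176); consequence proved here] [cite: CesnaviciusNeururerSaha2023, Lemma 6.5] -/
theorem natAbs_maninConstant₀_eq_of_cuspCoeff_eq_zero_of_ne (D₁ : Gamma1ParametrizationData W₁ N)
    (D₀ : ModularParametrizationData W₀ N) (hiso : IsIsogenous W₁ W₀) (h₁ : D₁.IsOptimal)
    (h₀ : ∀ z ∈ D₀.L.lattice, ∃ w ∈ periodLattice D₀.f, z = D₀.c * w) {p q : ℕ} (hp : p.Prime)
    (hq : q.Prime) (hne : p ≠ q) (hpN : p ∣ N) (hqN : q ∣ N) (hap : cuspCoeff D₀.f p = 0)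
    (haq : cuspCoeff D₀.f q = 0) :
    D₀.maninConstant.natAbs = D₁.maninConstant.natAbs := by
  rcases natAbs_maninConstant₀_eq_or_eq_mul_of_cuspCoeff_eq_zero D₁ D₀ hiso h₁ h₀ hp hpN hap with h | h
  · exact h
  rcases natAbs_maninConstant₀_eq_or_eq_mul_of_cuspCoeff_eq_zero D₁ D₀ hiso h₁ h₀ hq hqN haq with h' | h'
  · exact h'
  exfalso
  have hc₁ : D₁.maninConstant.natAbs ≠ 0 := Int.natAbs_ne_zero.mpr D₁.maninConstant_ne_zero
  exact hne (Nat.eq_of_mul_eq_mul_right (Nat.pos_of_ne_zero hc₁) (h.symm.trans h'))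

/-- Same with `p² ∣ N`, `q² ∣ N` (e.g. `36 ∣ N`: `|c₀| = |c₁|`). [cite: AtkinLehner1970, Thm. 3]
[cite: LingOesterle1991, Thm. 6 (p. 176); consequence proved here] -/
theorem natAbs_maninConstant₀_eq_of_sq_dvd_level_of_ne (D₁ : Gamma1ParametrizationData W₁ N)
    (D₀ : ModularParametrizationData W₀ N) (hiso : IsIsogenous W₁ W₀) (h₁ : D₁.IsOptimal)
    (h₀ : ∀ z ∈ D₀.L.lattice, ∃ w ∈ periodLattice D₀.f, z = D₀.c * w) {p q : ℕ} (hp : p.Prime)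
    (hq : q.Prime) (hne : p ≠ q) (hp2 : p ^ 2 ∣ N) (hq2 : q ^ 2 ∣ N) :
    D₀.maninConstant.natAbs = D₁.maninConstant.natAbs :=
  natAbs_maninConstant₀_eq_of_cuspCoeff_eq_zero_of_ne D₁ D₀ hiso h₁ h₀ hp hq hne
    ((dvd_pow_self p two_ne_zero).trans hp2) ((dvd_pow_self q two_ne_zero).trans hq2)
    (D₀.isNewformOf.1.cuspCoeff_eq_zero_of_sq_dvd hp hp2) (D₀.isNewformOf.1.cuspCoeff_eq_zero_of_sq_dvd hq hq2)

/-- **Away from the traceless prime the two optimal constants have the same valuation**: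
`ord_ℓ(c₀) = ord_ℓ(c₁)` for every prime `ℓ ≠ p` (from `|c₀| ∈ {|c₁|, p|c₁|}`).
[cite: LingOesterle1991, Thm. 6 (p. 176); consequence proved here] [cite: CesnaviciusNeururerSaha2023, Lemma 6.5] -/
theorem padicValInt_maninConstant₀_eq_of_cuspCoeff_eq_zero_of_ne (D₁ : Gamma1ParametrizationData W₁ N)
    (D₀ : ModularParametrizationData W₀ N) (hiso : IsIsogenous W₁ W₀) (h₁ : D₁.IsOptimal)
    (h₀ : ∀ z ∈ D₀.L.lattice, ∃ w ∈ periodLattice D₀.f, z = D₀.c * w) {p : ℕ} (hp : p.Prime)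
    (hpN : p ∣ N) (hap : cuspCoeff D₀.f p = 0) (ℓ : ℕ) [hℓ : Fact ℓ.Prime] (hℓp : ℓ ≠ p) :
    padicValInt ℓ D₀.maninConstant = padicValInt ℓ D₁.maninConstant := by
  have hc₁ : D₁.maninConstant.natAbs ≠ 0 := Int.natAbs_ne_zero.mpr D₁.maninConstant_ne_zero
  haveI : Fact p.Prime := ⟨hp⟩
  rw [padicValInt, padicValInt]
  rcases natAbs_maninConstant₀_eq_or_eq_mul_of_cuspCoeff_eq_zero D₁ D₀ hiso h₁ h₀ hp hpN hap with h | h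
  · rw [h]
  · rw [h, padicValNat.mul hp.ne_zero hc₁, padicValNat_primes hℓp, zero_add]

/-- **At the traceless prime itself: `ord_p(c₁) ≤ ord_p(c₀) ≤ ord_p(c₁) + 1`.**
[cite: LingOesterle1991, Thm. 6 (p. 176); consequence proved here] [cite: CesnaviciusNeururerSaha2023, Lemma 6.5] -/
theorem padicValInt_maninConstant₀_le_succ_of_cuspCoeff_eq_zero (D₁ : Gamma1ParametrizationData W₁ N)
    (D₀ : ModularParametrizationData W₀ N) (hiso : IsIsogenous W₁ W₀) (h₁ : D₁.IsOptimal)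
    (h₀ : ∀ z ∈ D₀.L.lattice, ∃ w ∈ periodLattice D₀.f, z = D₀.c * w) {p : ℕ} [hp : Fact p.Prime]
    (hpN : p ∣ N) (hap : cuspCoeff D₀.f p = 0) :
    padicValInt p D₁.maninConstant ≤ padicValInt p D₀.maninConstant ∧
      padicValInt p D₀.maninConstant ≤ padicValInt p D₁.maninConstant + 1 := by
  have hc₁ : D₁.maninConstant.natAbs ≠ 0 := Int.natAbs_ne_zero.mpr D₁.maninConstant_ne_zero
  rw [padicValInt, padicValInt]
  rcases natAbs_maninConstant₀_eq_or_eq_mul_of_cuspCoeff_eq_zero D₁ D₀ hiso h₁ h₀ hp.out hpN hap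
    with h | h
  · rw [h]
    exact ⟨le_rfl, Nat.le_succ _⟩
  · rw [h, padicValNat.mul hp.out.ne_zero hc₁, padicValNat.self hp.out.one_lt]
    omega

end Literature.NumberTheory.EllipticCurves.ModularForms

end
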